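import Literature.GroupTheory.CombinatorialGroupTheory.PuncturedSurfaceGroupLoopTwist
import Literature.AnabelianGeometry.SemiGraphs.PSCSeparatingCoveringsClosedSurfaceEdges
import Literature.AnabelianGeometry.SemiGraphs.PSCUnrVerticialSeparatingCoveringsIrreducibleNodal
import HarnessLib

/-!
# [CombGC] Prop. 1.2, proof p. 9: EDGE-LIKE separating coverings at the UNPOINTED irreducible nodal carrier `Π = Γ̂_{g,0}` — the loop node

Mochizuki, *A combinatorial version of the Grothendieck conjecture*, Tohoku Math. J. **59** (2007) [CombGC],
PROOF of Prop. 1.2, p. 9, the resp'd (edge) case ("there exists a finite étale … `Π_G`-covering `G' → G` whose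
restriction to the anabelioid `G_{e₂}` is trivial …, but whose restriction to the anabelioid `G_{e₁}` is
nontrivial … by gluing together appropriate finite étale coverings of the anabelioids `G_v`, `G_e`")
[cite: MochizukiCombGC2007, Prop 1.2 proof p.9], typed LEVEL-WISE as `PSCDatum.EdgeLikeSeparatingCoverings`
(row P12-L01-E; instance form of abc-iut FACT-LIST row F-2827), with Prop. 1.2 (i)/(ii) via abc-iut-w5-d183's
`prop12_of_separating`.

PROOF-ONLY file (abc-iut-f-060 gen 9; row «NODE-RESIDUAL@UNMARKED» of abc-iut-L3-lead γ85; 0 definitions).  The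
carrier: the UNPOINTED irreducible one-nodal datum (`exists_irreducibleNodalDatum Σ g 0`, `g ≥ 2`): one vertex
`cl ι⟨b_0, a_0 b_0 a_0⁻¹, a_i, b_i (i ≥ 1)⟩` (the HNN vertex, genus `g − 1`), one LOOP with node group `cl ι⟨b_0⟩`,
`Π` a pro-`Σ` completion of the closed surface group `Γ_{g,0}`; no cusps, so the edge pairs are the pairs of
distinct LEVEL nodes over the loop.  They are separated by the LOOP TWIST
`PuncturedSurfaceGroup.exists_levelHom_loopTwist` (`PuncturedSurfaceGroupLoopTwist.lean`):

* `Heisenberg.exists_heisenbergTriple_inl` — the Heisenberg triple of order `q³` together with the abelian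
  normal subgroup `inl(ℤ/q × ℤ/q) ∋ Y` (the coefficient data the loop twist needs);
* `PuncturedSurfaceGroup.exists_normal_separating_loopTwist` — the separating level `Ker ψ ⊴ ι⁻¹(V)`;
* `IsProSigmaCompletion.loopTwist_exists_open_separating_sameNode` — distinct level nodes `Vγ₁cl ι⟨b_0⟩ ≠
  Vγ₂cl ι⟨b_0⟩` are separated by an open `U ≤ V`, normal in `V` (ANY `r`; `g ≥ 2`, `ℓ ∈ Σ`);
* `edgeLikeSeparatingCoverings_of_irreducibleNodalClosed` — ★ F-2827 (`V' := V`) at EVERY unpointed irreducible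
  one-nodal datum; `separatingCoverings_of_irreducibleNodalClosed` (F-2829: with F-2826 of abc-iut-w5-d183 and
  F-2828 of abc-iut-f-164), `prop12_of_irreducibleNodalClosed` — ALL FIVE typed clauses of Prop. 1.2 (i)/(ii), in
  particular the loop node is COMMENSURABLY TERMINAL;
* `irreducibleNodalClosedOrigin_prop12_rows`, `exists_irreducibleNodalClosedOrigin_prop12_holds_all` — F-0438
  (both clauses), F-0459, F-2830 at every origin of such data, NON-VACUOUSLY (`Γ_{g,0}`, every `g ≥ 2`, every `Σ`).

The cusped irreducible nodal carriers are abc-iut-w5-d174's (`PSCSeparatingCoveringsIrreducibleNodal*.lean`,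
`≥ 2` cusps); nothing of those is restated.  Instance forms at data of the shape of genuine stable curves; nothing
here takes a side on [IUTchIII] Cor. 3.12.
-/

noncomputable section

open Multiplicative

/-! ### The Heisenberg triple with its abelian normal subgroup -/

namespace Literature.AnabelianGeometry.SemiGraphs.Heisenberg

open SemidirectProduct

/-- **A Heisenberg triple with central commutator and the abelian normal subgroup of `Y`**: in
`H_q = (ℤ/q × ℤ/q) ⋊_φ ℤ/q` (`φ` the shear action) the elements `X = (0; 1)`, `Y = ((1,0); 0)`, `Z = ((0,1); 0)`
satisfy `X Y X⁻¹ Y⁻¹ = Z`, `Z` is central, `Z^m = 1 ↔ q ∣ m`, `|H_q| = q³`, and `C = inl(ℤ/q × ℤ/q)` is a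
commutative subgroup containing `Y`, normalised by `X`. [cite: MochizukiSemiAnbd2006, Ex. 2.10 p.31] -/
theorem exists_heisenbergTriple_inl (q : ℕ) :
    ∃ (φ : Multiplicative (ZMod q) →* MulAut (Multiplicative (ZMod q × ZMod q)))
      (X Y Z : Multiplicative (ZMod q × ZMod q) ⋊[φ] Multiplicative (ZMod q))
      (C : Subgroup (Multiplicative (ZMod q × ZMod q) ⋊[φ] Multiplicative (ZMod q))),
      X * Y * X⁻¹ * Y⁻¹ = Z ∧ Z ∈ Subgroup.center (Multiplicative (ZMod q × ZMod q) ⋊[φ] Multiplicative (ZMod q)) ∧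
        (∀ m : ℕ, Z ^ m = 1 ↔ q ∣ m) ∧ Nat.card (Multiplicative (ZMod q × ZMod q) ⋊[φ] Multiplicative (ZMod q)) = q ^ 3 ∧
        (∀ y ∈ C, ∀ y' ∈ C, y * y' = y' * y) ∧ (∀ y ∈ C, X * y * X⁻¹ ∈ C) ∧ Y ∈ C := by
  obtain ⟨φ, hφ⟩ := exists_shearAction q
  refine ⟨φ, inr (ofAdd 1), inl (ofAdd (1, 0)), inl (ofAdd (0, 1)),
    (inl : Multiplicative (ZMod q × ZMod q) →* _ ⋊[φ] _).range, ?_, ?_, fun m => ?_, ?_, ?_, ?_, ⟨_, rfl⟩⟩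
  · have h1 : (inr (ofAdd (1 : ZMod q)) : Multiplicative (ZMod q × ZMod q) ⋊[φ] Multiplicative (ZMod q)) *
        inl (ofAdd (1, 0)) * (inr (ofAdd 1))⁻¹ = inl (ofAdd (1, 1)) := by
      rw [← map_inv, ← inl_aut, hφ]
      simp
    rw [h1, ← map_inv, ← map_mul, inl_inj, ← ofAdd_neg, ← ofAdd_add]
    simp
  · refine Subgroup.mem_center_iff.mpr fun w => SemidirectProduct.ext ?_ ?_
    · rw [mul_left, mul_left, left_inl, right_inl, map_one, MulAut.one_apply, hφ, mul_comm]
      simp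
    · rw [mul_right, mul_right, right_inl, mul_one, one_mul]
  · rw [← map_pow, ← (inl : _ →* Multiplicative (ZMod q × ZMod q) ⋊[φ] Multiplicative (ZMod q)).map_one, inl_inj,
      ← ofAdd_nsmul, ← ofAdd_zero, ofAdd.apply_eq_iff_eq, Prod.smul_mk, smul_zero, nsmul_eq_mul,
      mul_one, Prod.mk_eq_zero, eq_self_iff_true, true_and, ZMod.natCast_eq_zero_iff]
  · rw [SemidirectProduct.card, Nat.card_congr (toAdd : Multiplicative (ZMod q × ZMod q) ≃ _),
      Nat.card_congr (toAdd : Multiplicative (ZMod q) ≃ _), Nat.card_prod, Nat.card_zmod]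
    ring
  · rintro _ ⟨n₁, rfl⟩ _ ⟨n₂, rfl⟩
    rw [← map_mul, ← map_mul, mul_comm]
  · rintro _ ⟨n, rfl⟩
    exact ⟨φ (ofAdd 1) n, by rw [inl_aut, map_inv]⟩

end Literature.AnabelianGeometry.SemiGraphs.Heisenberg

/-! ### The separating level of the loop twist (discrete packaging) -/

namespace Literature.GroupTheory.CombinatorialGroupTheory.PuncturedSurfaceGroup

open scoped Pointwise

variable {g r : ℕ}

/-- **Separating level for the loop node** ([CombGC] Prop. 1.2 proof p. 9, edge case, discrete form): in the
setting of `exists_levelHom_loopTwist` with `M` finite, some `U ⊴ N` with `[N : U] ∣ |M|` misses an element of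
`f₁⟨b_0⟩f₁⁻¹ ∩ N` and contains `f₂⟨b_0⟩f₂⁻¹ ∩ N` whenever `f₁⁻¹ f₂ ∉ ⟨b_0⟩·N`.  Output shape of the discrete
suppliers of `IsProSigmaCompletion.exists_open_unrSeparating_of_discrete`. [cite: MochizukiCombGC2007, Prop 1.2 proof p.9] -/
theorem exists_normal_separating_loopTwist (hg : 2 ≤ g)
    (N : Subgroup (PuncturedSurfaceGroup g r)) [hN : N.Normal] [N.FiniteIndex]
    {M : Type*} [Group M] [Finite M] {X Y Z : M} (hXYZ : X * Y * X⁻¹ * Y⁻¹ = Z)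
    (hZ : Z ∈ Subgroup.center M) (C : Subgroup M) (hCc : ∀ y ∈ C, ∀ y' ∈ C, y * y' = y' * y)
    (hXC : ∀ y ∈ C, X * y * X⁻¹ ∈ C) (hYC : Y ∈ C) {q : ℕ} (hZq : ∀ m : ℕ, Z ^ m = 1 ↔ q ∣ m)
    (hq : N.index ^ 3 < q) (f₁ : PuncturedSurfaceGroup g r) :
    ∃ U : Subgroup N, U.Normal ∧ U.index ∣ Nat.card M ∧ U.FiniteIndex ∧
      (∃ z ∈ (ConjAct.toConjAct f₁ • Subgroup.zpowers (b (r := r) (⟨0, by omega⟩ : Fin g))) ⊓ N,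
        z ∉ U.map N.subtype) ∧
      ∀ f₂ : PuncturedSurfaceGroup g r,
        f₁⁻¹ * f₂ ∉ (Subgroup.zpowers (b (r := r) (⟨0, by omega⟩ : Fin g)) : Set (PuncturedSurfaceGroup g r)) *
            (N : Set (PuncturedSurfaceGroup g r)) →
        (ConjAct.toConjAct f₂ • Subgroup.zpowers (b (r := r) (⟨0, by omega⟩ : Fin g))) ⊓ N ≤ U.map N.subtype := by
  classical
  obtain ⟨ψ, halive, hkill⟩ := exists_levelHom_loopTwist hg N hXYZ hZ C hCc hXC hYC hZq hq f₁
  refine ⟨ψ.ker, inferInstance, ?_, ?_, ?_, ?_⟩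
  · rw [Subgroup.index_ker]
    exact Subgroup.card_subgroup_dvd_card ψ.range
  · exact ⟨fun h0 => (Nat.card_pos (α := ψ.range)).ne' (by rwa [Subgroup.index_ker] at h0)⟩
  · refine ⟨f₁ * b ⟨0, by omega⟩ ^ N.index * f₁⁻¹,
      Subgroup.mem_inf.mpr ⟨?_, hN.conj_mem _ (Subgroup.pow_index_mem N _) f₁⟩, fun hmem => ?_⟩
    · rw [Subgroup.mem_smul_pointwise_iff_exists]
      exact ⟨b ⟨0, by omega⟩ ^ N.index, Subgroup.npow_mem_zpowers _ _, by
        rw [ConjAct.smul_def, ConjAct.ofConjAct_toConjAct]⟩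
    · obtain ⟨u, hu, hu'⟩ := Subgroup.mem_map.mp hmem
      refine halive ?_
      rw [← show u = ⟨f₁ * b ⟨0, by omega⟩ ^ N.index * f₁⁻¹, hN.conj_mem _ (Subgroup.pow_index_mem N _) f₁⟩ from
        Subtype.ext hu']
      exact hu
  · intro f₂ hf₂ z hz
    exact Subgroup.mem_map.mpr ⟨⟨z, hz.2⟩, hkill f₂ hf₂ z hz, rfl⟩

end Literature.GroupTheory.CombinatorialGroupTheory.PuncturedSurfaceGroup

namespace Literature.AnabelianGeometry.SemiGraphs

open scoped Pointwise
open Literature.AnabelianGeometry.Anabelioids (IsSigmaInteger)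
open Literature.GroupTheory.CombinatorialGroupTheory
open Literature.GroupTheory.CombinatorialGroupTheory.PuncturedSurfaceGroup (a b c exists_normal_separating_loopTwist)

/-! ### The same-node separating covering at the loop, from the loop twist -/

namespace SemiGraphOfAnabelioids.IsProSigmaCompletion

variable {Sigma : Set ℕ} {g r : ℕ} {P : Type*} [Group P] [TopologicalSpace P] [IsTopologicalGroup P]
  [CompactSpace P] [TotallyDisconnectedSpace P] {ι : PuncturedSurfaceGroup g r →* P}

/-- **[CombGC] Prop. 1.2, proof p. 9 — the edge-like separating covering at the LOOP NODE, loop-twist form.**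
`ι : Γ_{g,r} → Π` a pro-`Σ` completion (`Π` profinite; any `r`), `g ≥ 2`, `A = cl ι⟨b_0⟩` the node group of the
loop, `ℓ ∈ Σ` prime, `V ⊴ Π` open.  Two DISTINCT level nodes `Vγ₁A ≠ Vγ₂A` are separated by an open `U ≤ V`,
normal in `V`, with `γ₂Aγ₂⁻¹ ∩ V ≤ U` and `γ₁Aγ₁⁻¹ ∩ V ⊄ U`. [cite: MochizukiCombGC2007, Prop 1.2 proof p.9] -/
theorem loopTwist_exists_open_separating_sameNode (hι : IsProSigmaCompletion Sigma ι) (hg : 2 ≤ g)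
    {ℓ : ℕ} (hℓ : ℓ.Prime) (hℓS : ℓ ∈ Sigma)
    (A : Subgroup P) (hA : A = ((Subgroup.zpowers (b (r := r) (⟨0, by omega⟩ : Fin g))).map ι).topologicalClosure)
    (V : Subgroup P) [hVn : V.Normal] (hVo : IsOpen (V : Set P)) (γ₁ γ₂ : ConjAct P)
    (hne : DoubleCoset.doubleCoset (ConjAct.ofConjAct γ₁) (V : Set P) (A : Set P) ≠
      DoubleCoset.doubleCoset (ConjAct.ofConjAct γ₂) (V : Set P) (A : Set P)) :
    ∃ U : Subgroup P, IsOpen (U : Set P) ∧ U ≤ V ∧ (U.subgroupOf V).Normal ∧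
      (γ₂ • A) ⊓ V ≤ U ∧ ¬ ((γ₁ • A) ⊓ V ≤ U) := by
  classical
  set x : PuncturedSurfaceGroup g r := b ⟨0, by omega⟩ with hxdef
  haveI hKfi : (V.comap ι).FiniteIndex := finiteIndex_comap hι V hVo
  set m : ℕ := (V.comap ι).index with hm
  -- the Heisenberg group mod `q = ℓ^{m³}`
  set q : ℕ := ℓ ^ (m ^ 3) with hq
  have hmq : m ^ 3 < q := Nat.lt_pow_self hℓ.one_lt
  obtain ⟨φ, X, Y, Z, C, hXYZ, hZc, hZq, hcard, hCc, hXC, hYC⟩ := Heisenberg.exists_heisenbergTriple_inl q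
  haveI : Finite (Multiplicative (ZMod q × ZMod q) ⋊[φ] Multiplicative (ZMod q)) :=
    Nat.finite_of_card_ne_zero (by rw [hcard]; exact pow_ne_zero _ (pow_ne_zero _ hℓ.ne_zero))
  -- representatives of the two level nodes in `ι(Γ)`, up to `V`
  obtain ⟨f₁, w₁, hw₁, -, hA₁, hdc₁⟩ := exists_rep_unr hι A ⊥ V hVo γ₁
  obtain ⟨f₂, w₂, hw₂, -, hA₂, hdc₂⟩ := exists_rep_unr hι A ⊥ V hVo γ₂
  rw [sup_bot_eq] at hdc₁ hdc₂
  have hδ : f₁⁻¹ * f₂ ∉ (Subgroup.zpowers x : Set (PuncturedSurfaceGroup g r)) * (V.comap ι : Set _) := by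
    intro hmem
    obtain ⟨a', ha', k, hk, hak⟩ := Set.mem_mul.mp hmem
    apply hne
    rw [hdc₁, hdc₂]
    symm
    have hkV : ι k ∈ V := hk
    have haA : ι a' ∈ A := by rw [hA]; exact Subgroup.le_topologicalClosure _ (Subgroup.mem_map_of_mem ι ha')
    refine DoubleCoset.doubleCoset_eq_of_mem (DoubleCoset.mem_doubleCoset.mpr
      ⟨ι f₁ * ι a' * ι k * (ι f₁ * ι a')⁻¹, hVn.conj_mem _ hkV (ι f₁ * ι a'), ι a', haA, ?_⟩)
    have hf₂ : f₂ = f₁ * (a' * k) := by rw [hak, mul_inv_cancel_left]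
    rw [hf₂, map_mul, map_mul]
    group
  -- the loop twist at the discrete level `K = ι⁻¹(V)`
  obtain ⟨U', hU'n, hidx, hfi, halive, hkill⟩ :=
    exists_normal_separating_loopTwist hg (V.comap ι) hXYZ hZc C hCc hXC hYC hZq (by rw [← hm]; exact hmq) f₁
  haveI := hU'n
  have hU'S : IsSigmaInteger Sigma U'.index := by
    rw [hcard, hq, ← pow_mul] at hidx
    exact ⟨Nat.pos_of_ne_zero hfi.index_ne_zero, fun p hp hpd =>
      (isSigmaInteger_prime_pow hℓ hℓS _).2 p hp (hpd.trans hidx)⟩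
  -- transfer along the completion `V` of `K`
  obtain ⟨U, hUo, hUV, hUn, hk, ha⟩ := exists_open_unrSeparating_of_discrete hι (Subgroup.zpowers x)
    (Subgroup.zpowers x) ⊥ V hVo f₁ f₂ U' hU'S (by rw [sup_bot_eq]; exact hkill f₂ hδ) halive
  haveI := hUn
  refine ⟨U, hUo, hUV, hUn, ?_, ?_⟩
  · rw [hA₂, ← conjAct_smul_eq_of_subgroupOf_normal hUV hw₂, Subgroup.pointwise_smul_le_pointwise_smul_iff]
    exact le_trans (inf_le_inf_right V (by rw [hA]; exact le_sup_left)) hk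
  · rw [hA₁, ← conjAct_smul_eq_of_subgroupOf_normal hUV hw₁, Subgroup.pointwise_smul_le_pointwise_smul_iff, hA]
    exact ha

end SemiGraphOfAnabelioids.IsProSigmaCompletion

/-! ### The unpointed irreducible nodal carrier -/

namespace PSCDatum

open SemiGraphOfAnabelioids (IsProSigmaCompletion)
open SemiGraphOfAnabelioids.IsProSigmaCompletion (loopTwist_exists_open_separating_sameNode)

variable {P : Type} [Group P] [TopologicalSpace P] [IsTopologicalGroup P]
variable [CompactSpace P] [TotallyDisconnectedSpace P] {Sigma : Set ℕ} {g : ℕ}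

/-- **Row F-2827 `EdgeLikeSeparatingCoverings` (`V' := V`) at EVERY unpointed irreducible one-nodal datum**
(`Π` a pro-`Σ` completion of `Γ_{g,0}`, `g ≥ 2`, node group `Π_ν = cl ι⟨b_0⟩` the loop; no cusps, so the only
edge pairs are pairs of distinct LEVEL nodes over the loop): by the loop twist.
[cite: MochizukiCombGC2007, Prop 1.2 proof p.9] -/
theorem edgeLikeSeparatingCoverings_of_irreducibleNodalClosed (hne : Sigma.Nonempty)
    (hprime : ∀ p ∈ Sigma, p.Prime) (ι : PuncturedSurfaceGroup g 0 →* P)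
    (hι : IsProSigmaCompletion Sigma ι) (G : PSCDatum P) (hg : 1 ≤ g) (hg2 : 2 ≤ g)
    (e : G.graph.C ≃ Fin 0) (n₀ : G.graph.N) (hN : ∀ n, n = n₀)
    (hE : G.nodeGp n₀ = ((Subgroup.zpowers (PuncturedSurfaceGroup.b (r := 0) (⟨0, hg⟩ : Fin g))).map
      ι).topologicalClosure) :
    G.EdgeLikeSeparatingCoverings := by
  classical
  obtain ⟨ℓ, hℓS⟩ := hne
  have hℓ : ℓ.Prime := hprime ℓ hℓS
  intro V hVn hVo
  haveI := hVn
  refine ⟨V, hVn, hVo, le_rfl, fun e₁ e₂ γ₁ γ₂ hdist => ?_⟩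
  rcases e₁ with n₁ | c₁
  · rcases e₂ with n₂ | c₂
    · obtain rfl : n₁ = n₀ := hN n₁
      obtain rfl : n₂ = n₁ := hN n₂
      have hne' : DoubleCoset.doubleCoset (ConjAct.ofConjAct γ₁) (V : Set P) (G.nodeGp n₂ : Set P) ≠
          DoubleCoset.doubleCoset (ConjAct.ofConjAct γ₂) (V : Set P) (G.nodeGp n₂ : Set P) := by
        rcases hdist with h | h
        · exact absurd rfl h
        · exact h
      exact loopTwist_exists_open_separating_sameNode hι hg2 hℓ hℓS (G.nodeGp n₂) hE V hVo γ₁ γ₂ hne'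
    · exact (e c₂).elim0
  · exact (e c₁).elim0

/-- **Row F-2829 `SeparatingCoverings` — all three clauses — at every unpointed irreducible one-nodal datum**:
F-2826 (the vertex; abc-iut-w5-d183's vertex twist, `verticialSeparatingCoverings_of_irreducibleNodalClosed`),
F-2827 (the loop; this file) and F-2828 (`Π^unr`; abc-iut-f-164's `unrRows_of_irreducibleNodal`).
[cite: MochizukiCombGC2007, Prop 1.2 proof p.9] -/
theorem separatingCoverings_of_irreducibleNodalClosed (hne : Sigma.Nonempty)
    (hprime : ∀ p ∈ Sigma, p.Prime) (ι : PuncturedSurfaceGroup g 0 →* P)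
    (hι : IsProSigmaCompletion Sigma ι) (G : PSCDatum P) (hg : 1 ≤ g) (hg2 : 2 ≤ g)
    (e : G.graph.C ≃ Fin 0) (v₀ : G.graph.V) (hV : ∀ w, w = v₀) (n₀ : G.graph.N) (hN : ∀ n, n = n₀)
    (hE : G.nodeGp n₀ = ((Subgroup.zpowers (PuncturedSurfaceGroup.b (r := 0) (⟨0, hg⟩ : Fin g))).map
      ι).topologicalClosure)
    (hV₀ : G.vertGp v₀ = ((Subgroup.closure {x : PuncturedSurfaceGroup g 0 |
        x = PuncturedSurfaceGroup.b ⟨0, hg⟩ ∨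
        x = PuncturedSurfaceGroup.a ⟨0, hg⟩ * PuncturedSurfaceGroup.b ⟨0, hg⟩ * (PuncturedSurfaceGroup.a ⟨0, hg⟩)⁻¹ ∨
        (∃ i : Fin g, 1 ≤ (i : ℕ) ∧ (x = PuncturedSurfaceGroup.a i ∨ x = PuncturedSurfaceGroup.b i)) ∨
        ∃ j : Fin 0, x = PuncturedSurfaceGroup.c j}).map ι).topologicalClosure)
    (hgen : G.genus v₀ = g - 1) :
    G.SeparatingCoverings :=
  ⟨G.verticialSeparatingCoverings_of_irreducibleNodalClosed hne hprime ι hι hg hg2 v₀ hV hV₀,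
    G.edgeLikeSeparatingCoverings_of_irreducibleNodalClosed hne hprime ι hι hg hg2 e n₀ hN hE,
    (G.unrRows_of_irreducibleNodal hne hprime ι hι hg e (fun c' => (e c').elim0) v₀ hV n₀ hN hE hV₀ hgen).1⟩

/-- **[CombGC] Prop. 1.2 (i) and (ii), ALL typed clauses, at every unpointed irreducible one-nodal datum**
(`g ≥ 2`): in particular the loop node `cl ι⟨b_0⟩` is commensurably terminal in `Π_G` (`prop12_of_separating`).
[cite: MochizukiCombGC2007, Prop 1.2 pp.8-9] -/
theorem prop12_of_irreducibleNodalClosed (hne : Sigma.Nonempty)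
    (hprime : ∀ p ∈ Sigma, p.Prime) (ι : PuncturedSurfaceGroup g 0 →* P)
    (hι : IsProSigmaCompletion Sigma ι) (G : PSCDatum P) (hg : 1 ≤ g) (hg2 : 2 ≤ g)
    (e : G.graph.C ≃ Fin 0) (v₀ : G.graph.V) (hV : ∀ w, w = v₀) (n₀ : G.graph.N) (hN : ∀ n, n = n₀)
    (hE : G.nodeGp n₀ = ((Subgroup.zpowers (PuncturedSurfaceGroup.b (r := 0) (⟨0, hg⟩ : Fin g))).map
      ι).topologicalClosure)
    (hV₀ : G.vertGp v₀ = ((Subgroup.closure {x : PuncturedSurfaceGroup g 0 |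
        x = PuncturedSurfaceGroup.b ⟨0, hg⟩ ∨
        x = PuncturedSurfaceGroup.a ⟨0, hg⟩ * PuncturedSurfaceGroup.b ⟨0, hg⟩ * (PuncturedSurfaceGroup.a ⟨0, hg⟩)⁻¹ ∨
        (∃ i : Fin g, 1 ≤ (i : ℕ) ∧ (x = PuncturedSurfaceGroup.a i ∨ x = PuncturedSurfaceGroup.b i)) ∨
        ∃ j : Fin 0, x = PuncturedSurfaceGroup.c j}).map ι).topologicalClosure)
    (hgen : G.genus v₀ = g - 1) :
    (G.VerticialOpenInterDeterminesVertex ∧ G.EdgeLikeOpenInterDeterminesEdge ∧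
      G.UnrVerticialOpenInterDeterminesVertex) ∧
    (G.VerticialEdgeLikeCommensurablyTerminal ∧ G.UnrVerticialCommensurablyTerminal) :=
  G.prop12_of_separating (G.separatingCoverings_of_irreducibleNodalClosed hne hprime ι hι hg hg2 e v₀ hV n₀ hN
    hE hV₀ hgen)

/-! ### Origin level: F-0438 (in full), F-0459, F-2830 at every origin of unpointed irreducible nodal data -/

/-- **F-0438 `CommensurableTerminalityHolds Ω` (BOTH clauses), F-0459 `OpenInterDeterminesComponentHolds Ω`
and F-2830 `SeparatingCoveringsHolds Ω` at EVERY origin whose data are unpointed irreducible one-nodal data**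
(hypothesis shape of `exists_irreducibleNodalDatum` at `r = 0`, `g ≥ 2`, profinite `Π` in `Type`, with the node,
(vacuous) cusp and genus pins). [cite: MochizukiCombGC2007, Prop 1.2 pp.8-9] -/
theorem irreducibleNodalClosedOrigin_prop12_rows (Ω : PSCOrigin.{0})
    (hΩ : ∀ ⦃Q : Type⦄ [Group Q] [TopologicalSpace Q] [IsTopologicalGroup Q] (G : PSCDatum Q),
      Ω.IsOfPSCType G → CompactSpace Q ∧ TotallyDisconnectedSpace Q ∧
        ∃ (S : Set ℕ) (g : ℕ) (hg : 1 ≤ g) (ι : PuncturedSurfaceGroup g 0 →* Q) (e : G.graph.C ≃ Fin 0)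
          (v₀ : G.graph.V) (n₀ : G.graph.N),
          S.Nonempty ∧ (∀ p ∈ S, p.Prime) ∧ IsProSigmaCompletion S ι ∧ 2 ≤ g ∧
          (∀ c, G.cuspGp c =
            ((PuncturedSurfaceGroup.cuspInertia (g := g) (e c)).map ι).topologicalClosure) ∧
          (∀ w, w = v₀) ∧ (∀ n, n = n₀) ∧
          G.nodeGp n₀ = ((Subgroup.zpowers (PuncturedSurfaceGroup.b (r := 0) (⟨0, hg⟩ : Fin g))).map
            ι).topologicalClosure ∧
          G.vertGp v₀ = ((Subgroup.closure {x : PuncturedSurfaceGroup g 0 |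
            x = PuncturedSurfaceGroup.b ⟨0, hg⟩ ∨
            x = PuncturedSurfaceGroup.a ⟨0, hg⟩ * PuncturedSurfaceGroup.b ⟨0, hg⟩ * (PuncturedSurfaceGroup.a ⟨0, hg⟩)⁻¹ ∨
            (∃ i : Fin g, 1 ≤ (i : ℕ) ∧ (x = PuncturedSurfaceGroup.a i ∨ x = PuncturedSurfaceGroup.b i)) ∨
            ∃ j : Fin 0, x = PuncturedSurfaceGroup.c j}).map ι).topologicalClosure ∧
          G.genus v₀ = g - 1) :
    CommensurableTerminalityHolds Ω ∧ OpenInterDeterminesComponentHolds Ω ∧ SeparatingCoveringsHolds Ω := by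
  have hsep : SeparatingCoveringsHolds Ω := by
    intro Q _ _ _ G hG
    obtain ⟨hc, hd, S, g, hg, ι, e, v₀, n₀, hne, hprime, hι, hg2, -, hV, hN, hE, hV₀, hgen⟩ := hΩ G hG
    haveI := hc
    haveI := hd
    exact G.separatingCoverings_of_irreducibleNodalClosed hne hprime ι hι hg hg2 e v₀ hV n₀ hN hE hV₀ hgen
  have hprof : ∀ ⦃Q : Type⦄ [Group Q] [TopologicalSpace Q] [IsTopologicalGroup Q] (G : PSCDatum Q),
      Ω.IsOfPSCType G → CompactSpace Q ∧ TotallyDisconnectedSpace Q := fun Q _ _ _ G hG => by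
    obtain ⟨hc, hd, -⟩ := hΩ G hG
    exact ⟨hc, hd⟩
  exact ⟨commensurableTerminalityHolds_of_separating Ω hsep hprof,
    openInterDeterminesComponentHolds_of_separating Ω hsep hprof, hsep⟩

/-- **Non-vacuity: at the inhabited origin of unpointed irreducible one-nodal data — for every nonempty set
`Σ` of primes and every arithmetic genus `g ≥ 2` — F-0438 ([CombGC] Prop. 1.2 (ii), BOTH clauses: the loop node
is commensurably terminal), F-0459 (Prop. 1.2 (i), all three clauses) and F-2830 (the separating coverings of the
proof of Prop. 1.2, all three cases) ALL HOLD**, the inhabitant being abc-iut-f-164's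
`exists_irreducibleNodalDatum Σ … g 0` over a pro-`Σ` completion of `Γ_{g,0}`.
[cite: MochizukiCombGC2007, Prop 1.2 pp.8-9] -/
theorem exists_irreducibleNodalClosedOrigin_prop12_holds_all (Sigma : Set ℕ) (hne : Sigma.Nonempty)
    (hprime : ∀ p ∈ Sigma, p.Prime) {g : ℕ} (hg2 : 2 ≤ g) :
    ∃ Ω : PSCOrigin.{0},
      (∃ (Q : ProfiniteGrp.{0}) (ι : PuncturedSurfaceGroup g 0 →* Q) (G : PSCDatum Q) (v₀ : G.graph.V),
        IsProSigmaCompletion Sigma ι ∧ Ω.IsOfPSCType G ∧ G.Sigma = Sigma ∧ G.graph.i = 1 ∧ G.graph.n = 1 ∧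
          G.graph.r = 0 ∧ (∀ w, w = v₀) ∧ G.genus v₀ = g - 1) ∧
      CommensurableTerminalityHolds Ω ∧ OpenInterDeterminesComponentHolds Ω ∧ SeparatingCoveringsHolds Ω := by
  classical
  have hg : 1 ≤ g := by omega
  let Ω : PSCOrigin.{0} :=
    ⟨fun {Q} _ _ G => ∃ (_ : IsTopologicalGroup Q), CompactSpace Q ∧ TotallyDisconnectedSpace Q ∧
        ∃ (S : Set ℕ) (g : ℕ) (hg : 1 ≤ g) (ι : PuncturedSurfaceGroup g 0 →* Q) (e : G.graph.C ≃ Fin 0)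
          (v₀ : G.graph.V) (n₀ : G.graph.N),
          S.Nonempty ∧ (∀ p ∈ S, p.Prime) ∧ IsProSigmaCompletion S ι ∧ 2 ≤ g ∧
          (∀ c, G.cuspGp c =
            ((PuncturedSurfaceGroup.cuspInertia (g := g) (e c)).map ι).topologicalClosure) ∧
          (∀ w, w = v₀) ∧ (∀ n, n = n₀) ∧
          G.nodeGp n₀ = ((Subgroup.zpowers (PuncturedSurfaceGroup.b (r := 0) (⟨0, hg⟩ : Fin g))).map
            ι).topologicalClosure ∧
          G.vertGp v₀ = ((Subgroup.closure {x : PuncturedSurfaceGroup g 0 |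
            x = PuncturedSurfaceGroup.b ⟨0, hg⟩ ∨
            x = PuncturedSurfaceGroup.a ⟨0, hg⟩ * PuncturedSurfaceGroup.b ⟨0, hg⟩ * (PuncturedSurfaceGroup.a ⟨0, hg⟩)⁻¹ ∨
            (∃ i : Fin g, 1 ≤ (i : ℕ) ∧ (x = PuncturedSurfaceGroup.a i ∨ x = PuncturedSurfaceGroup.b i)) ∨
            ∃ j : Fin 0, x = PuncturedSurfaceGroup.c j}).map ι).topologicalClosure ∧
          G.genus v₀ = g - 1⟩
  refine ⟨Ω, ?_, irreducibleNodalClosedOrigin_prop12_rows Ω fun Q _ _ _ G hG => hG.2⟩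
  obtain ⟨Q, ι, G, e, v₀, n₀, hι, hS, hi, hn, hr, hC, hV, hN, hE, hV₀, hgen, -⟩ :=
    exists_irreducibleNodalDatum Sigma hne hprime g 0 hg
  have hG : Ω.IsOfPSCType G := ⟨inferInstance, inferInstance, inferInstance, Sigma, g, hg, ι, e, v₀, n₀, hne, hprime,
    hι, hg2, hC, hV, hN, hE, hV₀, hgen⟩
  exact ⟨Q, ι, G, v₀, hι, hG, hS, hi, hn, hr, hV, hgen⟩

end PSCDatum

end Literature.AnabelianGeometry.SemiGraphs
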